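import Literature.Computability.Complexity.GateEliminationCase82Prep

/-!
# Gate elimination: the situation after the protected substitution (Case 8.2 of Li–Yang's Thm. 4.1)

Cases 8.2.2–8.2.5 of §4.1 (ECCC TR21-023, pp. 31–40) all start the same way: "Let `x_j ∈ I` be a
protected variable and `x_k` be its couple. We try to substitute `x_k ← d` and normalize the
circuit. After Case 6, exactly one gate (the descendant of `x_k`) is eliminated and
`Δμ = 1 + α_I + α_Q`." This file packages that situation — the second branch of the Case 6
dichotomy `Semicircuit.protSubst_dichotomy_sem` together with the couple bookkeeping — as a
structure `Semicircuit.ProtSubstSit`, proves that under the standing assumptions it is reached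
unless the one-step conclusion already holds (`Semicircuit.stepGoal_or_protSubstSit`), and
derives its basic API (the new circuit `K`, its source, fairness, dimensions, the freed variable
`x_j`, solutions and dependencies along the semantic link, untouched wires and out-degrees).

## References

* J. Li, T. Yang, *3.1n − o(n) circuit lower bounds for explicit functions*, STOC 2022;
  ECCC TR21-023, §4.1 (Case 6, Case 8.2.2, Case 8.2.5).
-/

namespace Literature.Computability.Complexity

open Finset

namespace Semicircuit

variable {n : ℕ} {C : Semicircuit n} {f : (Fin n → ZMod 2) → Bool} {R : RdqSource n} {d : ℕ} {αφ αI αQ : ℝ}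

/-- **The situation after the protected substitution `x_k := d` of Case 6** (second branch of
`protSubst_dichotomy_sem`), for the couple `(x_j, x_k)` of the quadratic equation `e` of `x_l`
and the reader `P_k` of `x_k`: the exact elimination `E` (bypass of `P_k` in `C[x_k := d]`, its
replacement node the other wire of `P_k`), the new circuit having no troubled gate and being
normalized, the measure drop `1 + α_I + α_Q`, and the semantic link `σ`.
[cite: LiYang2022, §4.1 (Case 6; Cases 8.2.2, 8.2.5: "After Case 6, exactly one gate … is eliminated and `Δμ = 1 + α_I + α_Q`")] -/
structure ProtSubstSit (C : Semicircuit n) (f : (Fin n → ZMod 2) → Bool) (R : RdqSource n) (αφ αI αQ : ℝ) where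
  /-- the freed variable `x_j` -/
  xj : Fin n
  /-- its couple `x_k`, substituted -/
  xk : Fin n
  /-- the quadratic variable of their equation -/
  l : Fin n
  /-- their quadratic equation -/
  e : QuadEq n
  /-- it is the equation of `x_l` -/
  he : R.quad l = some e
  /-- it reads `x_j` -/
  hjr : e.Reads xj
  /-- it reads `x_k` -/
  hkr : e.Reads xk
  /-- `x_k` is the couple of `x_j` -/
  other_eq : e.other xj = xk
  /-- the reader of `x_k` -/
  Pk : Fin C.m
  /-- the position at which it reads `x_k` -/
  ak : Fin 2
  /-- it reads `x_k` there -/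
  hPk : C.arg Pk ak = .var xk
  /-- the substituted constant -/
  dd : ZMod 2
  /-- the exact elimination: the bypass of `P_k` in `C[x_k := d]` -/
  E : ElimDataW (C.substConst xk (finTwoEquiv dd)) Pk f (RdqSource.assignProtected he hkr dd) αφ αI αQ ∅ (1 - αφ)
  /-- its replacement node is the other wire of `P_k` -/
  hrepl : E.repl = C.arg Pk ak.rev
  /-- no troubled gate afterwards -/
  noTroubled : ∀ T, ¬ E.C'.Troubled T
  /-- the new circuit is normalized -/
  normalized : E.C'.Normalized
  /-- the measure dropped by at least `1 + α_I + α_Q` -/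
  measure_le : E.C'.measure αφ αI αQ ∅ (RdqSource.assignProtected he hkr dd) + 1 + αI + αQ ≤ C.measure αφ αI αQ ∅ R
  /-- the negation pattern of the semantic link -/
  σ : Fin C.m → Bool
  /-- the semantic link: solutions of `C` with `x_k := d` restrict to the new circuit -/
  link : ∀ (xx : Fin n → Bool) (w : Fin C.m → Bool), C.Consistent (Function.update xx xk (finTwoEquiv dd)) w →
    E.C'.Consistent xx (fun k' => (w (E.ι k') ^^ σ (E.ι k')))

/-- **Case 6 inside Case 8.2**: under the standing assumptions with no ∧-type gate fed by two
variables, for a protected variable `x_j` and a constant `d`, either the one-step conclusion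
holds or the situation `ProtSubstSit` is reached with the freed variable `x_j` and the constant
`d`. [cite: LiYang2022, §4.1 (Case 6, Case 8.2.2)] -/
theorem stepGoal_or_protSubstSit (hf : IsAffineDisperser f d) (hd : 2 * d + 2 < R.dim) (hF : C.Fair)
    (hC : C.ComputesRestr f R) (hS : C.Standing R) (h2 : C.NoAndTwoVars)
    (hφ : 0 ≤ αφ) (hφ2 : αφ ≤ 1 / 2) (hI : 0 ≤ αI) (hQ : 0 ≤ αQ)
    {xj : Fin n} (hxj : R.Protected xj) (dd : ZMod 2) :
    C.StepGoal f R αφ αI αQ ∨ ∃ S : C.ProtSubstSit f R αφ αI αQ, S.xj = xj ∧ S.dd = dd := by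
  obtain ⟨hxjf, l, e, he, hjr⟩ := hxj
  have hjr : e.Reads xj := hjr
  obtain ⟨hkr, hxk, hkj⟩ := RdqSource.couple_spec he hjr
  obtain ⟨Pk, ak, hPk, -, -, -⟩ := hS.exists_reader_of_protected hxk
  rcases protSubst_dichotomy_sem hf hd hF hC hS h2 hφ hφ2 hI hQ hPk he hkr dd with h | ⟨E, hrepl, hT, hNo, hμ, σ, hlink⟩
  · exact Or.inl h
  · exact Or.inr ⟨⟨xj, e.other xj, l, e, he, hjr, hkr, rfl, Pk, ak, hPk, dd, E, hrepl, hT, hNo, hμ, σ, hlink⟩, rfl, rfl⟩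

namespace ProtSubstSit

variable (S : C.ProtSubstSit f R αφ αI αQ)

/-- The new circuit `K`. [folklore] -/
abbrev K : Semicircuit n := S.E.C'

/-- The new source `R₁ = R[x_k := d]`. [cite: LiYang2022, §2.4] -/
abbrev R₁ : RdqSource n := RdqSource.assignProtected S.he S.hkr S.dd

/-- The substituted circuit `C[x_k := d]`. [cite: LiYang2022, §2.4] -/
abbrev C₀ : Semicircuit n := C.substConst S.xk (finTwoEquiv S.dd)

/-- `K` is fair. [folklore] -/
theorem fair : S.K.Fair := S.E.fair

/-- `K` computes `f|_{R₁}`. [folklore] -/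
theorem computes : S.K.ComputesRestr f S.R₁ := S.E.computes

/-- `K` has one gate fewer. [folklore] -/
theorem m_add_one : S.K.m + 1 = C.m := S.E.m_add_one

/-- The dimension dropped by one. [folklore] -/
theorem dim_add_one : S.R₁.dim + 1 = R.dim := RdqSource.dim_assignProtected S.he S.hkr S.dd

/-- One quadratic equation was killed. [folklore] -/
theorem quadCount_add_one : S.R₁.quadCount + 1 = R.quadCount := RdqSource.quadCount_assignProtected S.he S.hkr S.dd

/-- `x_j ≠ x_k`. [folklore] -/
theorem xj_ne_xk : S.xj ≠ S.xk := by
  rw [← S.other_eq]; exact (S.e.other_ne S.hjr (R.quad_wf S.l S.e S.he).2.2).symm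

/-- `x_j` is free in `R₁`. [folklore] -/
theorem free_xj : S.R₁.Free S.xj :=
  (RdqSource.free_assignProtected_iff S.he S.hkr S.dd S.xj).mpr ⟨RdqSource.free_of_reads S.he S.hjr, S.xj_ne_xk⟩

/-- `x_j` is unprotected in `R₁` ("such that `x_j` becomes unprotected"). [cite: LiYang2022, §4.1 (Case 8.2.5)] -/
theorem not_protected_xj : ¬ S.R₁.Protected S.xj :=
  RdqSource.not_protected_assignProtected_of_reads S.he S.hkr S.dd S.hjr

/-- `x_k` is not free in `R₁`. [folklore] -/
theorem not_free_xk : ¬ S.R₁.Free S.xk := fun h =>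
  ((RdqSource.free_assignProtected_iff S.he S.hkr S.dd S.xk).mp h).2 rfl

/-- Protected variables of `R₁` were protected in `R`. [folklore] -/
theorem protected_of_protected {i : Fin n} (h : S.R₁.Protected i) : R.Protected i :=
  RdqSource.protected_of_protected_assignProtected S.he S.hkr S.dd h

/-- `x_j` and `x_k` were protected in `R`. [folklore] -/
theorem protected_xj : R.Protected S.xj := RdqSource.protected_of_reads S.he S.hjr

/-- `x_k` was protected in `R`. [folklore] -/
theorem protected_xk : R.Protected S.xk := RdqSource.protected_of_reads S.he S.hkr

/-- The empty packing of `K` has potential `0` (no troubled gate). [folklore] -/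
theorem potential_empty : S.K.potential ∅ = 0 := by
  classical
  have : S.K.troubledCount = 0 := by
    unfold troubledCount; rw [card_eq_zero, filter_eq_empty_iff]; exact fun T _ => S.noTroubled T
  unfold potential; rw [this]; simp

/-- **Solutions of `K`** are the solutions of `C` with `x_k := d`, up to the negations `σ`. [folklore] -/
theorem sol_eq (hF : C.Fair) (xx : Fin n → Bool) (k' : Fin S.K.m) :
    S.K.sol S.fair xx k' = (C.sol hF (Function.update xx S.xk (finTwoEquiv S.dd)) (S.E.ι k') ^^ S.σ (S.E.ι k')) :=
  sol_eq_of_link hF S.fair S.link xx k'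

/-- **Dependencies survive** at kept gates of the xor-part, for variables other than `x_k`.
[cite: LiYang2022, §4.1 (Cases 8.2.2.1, 8.2.2.2)] -/
theorem dependsOn (hF : C.Fair) {k' : Fin S.K.m} (hk' : k' ∈ S.K.xorPart) {s : Fin n} (hs : s ≠ S.xk)
    (hdep : C.DependsOn hF (S.E.ι k') s) : S.K.DependsOn S.fair k' s :=
  dependsOn_of_link hF S.fair S.link hk' hs hdep

/-- Membership in the xor-part is that of `C`. [folklore] -/
theorem mem_xorPart_iff (k' : Fin S.K.m) : k' ∈ S.K.xorPart ↔ S.E.ι k' ∈ C.xorPart := S.E.mem_xorPart_iff k'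

section Standing

variable (hS : C.Standing R)
include hS

/-- Only `P_k` reads `x_k` in `C`. [cite: LiYang2022, §4.1 (Case 1)] -/
theorem eq_Pk_of_reads {k : Fin C.m} {a : Fin 2} (h : C.arg k a = .var S.xk) : k = S.Pk :=
  hS.protected_one_reader S.xk S.protected_xk k S.Pk a S.ak h S.hPk

/-- Wires of `C[x_k := d]` at gates other than `P_k` are those of `C`. [folklore] -/
theorem arg_C₀_of_ne {k : Fin C.m} (hk : k ≠ S.Pk) (a : Fin 2) : S.C₀.arg k a = C.arg k a :=
  Node.substConst_of_ne (fun h => hk (S.eq_Pk_of_reads hS h)) _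

/-- **Wires of `K`**: at a kept gate, a wire of `C` not into `P_k` is kept. [folklore] -/
theorem embed_arg_of_ne {k' : Fin S.K.m} {a : Fin 2} (h : C.arg (S.E.ι k') a ≠ .gate S.Pk) :
    (S.K.arg k' a).embed S.E.ι = C.arg (S.E.ι k') a := by
  have := S.E.arg_eq k' a
  rw [S.arg_C₀_of_ne hS (S.E.ι_ne k')] at this
  rw [this, if_neg h]

/-- A wire of `C` into `P_k` becomes the other wire of `P_k`. [cite: LiYang2022, §3.3 (Rule 3)] -/
theorem embed_arg_of_eq {k' : Fin S.K.m} {a : Fin 2} (h : C.arg (S.E.ι k') a = .gate S.Pk) :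
    (S.K.arg k' a).embed S.E.ι = C.arg S.Pk S.ak.rev := by
  have := S.E.arg_eq k' a
  rw [S.arg_C₀_of_ne hS (S.E.ι_ne k')] at this
  rw [this, if_pos h, S.hrepl]

/-- A kept gate wire of `C` (not into `P_k`) is the corresponding gate wire of `K`. [folklore] -/
theorem arg_eq_gate {k' k'' : Fin S.K.m} {a : Fin 2} (h : C.arg (S.E.ι k') a = .gate (S.E.ι k'')) :
    S.K.arg k' a = .gate k'' := by
  rw [S.E.arg_eq_gate_iff, S.arg_C₀_of_ne hS (S.E.ι_ne k')]
  exact Or.inl h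

/-- A variable wire of `C` other than `x_k` is kept. [folklore] -/
theorem arg_eq_var {k' : Fin S.K.m} {a : Fin 2} {i : Fin n} (h : C.arg (S.E.ι k') a = .var i) :
    S.K.arg k' a = .var i := by
  rw [S.E.arg_eq_var_iff, S.arg_C₀_of_ne hS (S.E.ι_ne k')]
  exact Or.inl h

end Standing

/-- **Out-degrees of gates of `K`** other than the other wire of `P_k`: unchanged unless `P_k`
read them. [folklore] -/
theorem fanout_gate_add {k' : Fin S.K.m} (hk : C.arg S.Pk S.ak.rev ≠ .gate (S.E.ι k')) :
    S.K.fanout (.gate k') + (univ.filter fun a : Fin 2 => C.arg S.Pk a = .gate (S.E.ι k')).card = C.fanout (.gate (S.E.ι k')) := by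
  have h := S.E.fanout_gate_add (k' := k') (by rw [S.hrepl]; exact hk)
  have e1 : (univ.filter fun a : Fin 2 => S.C₀.arg S.Pk a = .gate (S.E.ι k')) =
      univ.filter fun a : Fin 2 => C.arg S.Pk a = .gate (S.E.ι k') := by
    ext a; simp only [mem_filter, mem_univ, true_and]
    show (C.arg S.Pk a).substConst S.xk _ = _ ↔ _
    rw [Node.substConst_eq_gate_iff]
  rw [e1, C.fanout_substConst_gate] at h
  exact h

/-- Out-degrees of variables of `K` other than `x_k` and the other wire of `P_k`. [folklore] -/
theorem fanout_var_eq {i : Fin n} (hik : i ≠ S.xk) (hi : C.arg S.Pk S.ak.rev ≠ .var i) :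
    S.K.fanout (.var i) = C.fanout (.var i) := by
  have h := S.E.fanout_var_add (i := i) (by rw [S.hrepl]; exact hi)
  have e0 : (univ.filter fun a : Fin 2 => S.C₀.arg S.Pk a = .var i).card = 0 := by
    rw [card_eq_zero, filter_eq_empty_iff]
    intro a _ ha
    have ha' := Node.substConst_eq_var_iff.mp ha
    rcases fin2_eq_or_eq_rev S.ak a with rfl | rfl
    · rw [S.hPk] at ha'; exact hik (Node.var.inj ha'.1).symm
    · exact hi ha'.1
  rw [e0, add_zero, C.fanout_substConst_var_of_ne _ _ hik] at h
  exact h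


end ProtSubstSit

end Semicircuit

end Literature.Computability.Complexity
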